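import Summits.QuantumFields.YangMills.Theorems.AlphaInputsT3ACMinimiserPinMeasurable
import Summits.QuantumFields.Balaban3D.Carriers.Regions
import Literature.MathematicalPhysics.QuantumFieldTheory.Balaban1983to89.B10Eq42TorusConstraint
import HarnessLib

/-!
# `AlphaInputsT3ACMinimiserPinRows` — THE PINNED TRIVIAL-HISTORY MINIMISERS OF RUN `K` SATISFY ALL THREE MINIMISER ROWS AT THE TRIVIAL
# HISTORY: r1 ([7] Thm 1, the pin), r2 ((42) top constraint `Ū^k = W` — the pin IS a point of the descent fibre) and r3 ((68) multi-level
# regularity — [Balaban1985Averaging] Prop. 2 along the pin, uniformly in the shell) — lane `pub-balaban3d`, seat alpha-1 (g6)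

Cell `ym3-torus`, route `UnitScaleTilt`, crux 2′ `stub_laneRecordsV3` (stmt-QuantumFields-19936 ∕ -19935), strategy B: with `…MinimiserPin` (existence)
and `…MinimiserPinMeasurable` (selection) the record's trivial-history minimisers `U_k(·, triv)` are PINNED from the displayed [7] schema
`T3PrintedMinimiserExistence.Thm1GlobalMinAt`.  This file shows that the pinned family ALSO delivers the other two minimiser rows of
`AlphaInputsT3ACv2.MinimiserRowsT3` at the trivial history — so that the adapted class of lane B is needed at `h ≠ triv` only:
* §1 letters: `PlaqSmall` through `fieldShift`; the cancellation `fieldShift ∘ avg^{j₁} = fieldShift W ⇒ avg^{j₂} = W` along `j₁ = j₂`; the window of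
  `ChargedT3` at the trivial history is a `PlaqSmall` statement (`Carriers.Omega_triv`: `Ω_j(triv) = T_η`); power bookkeeping.
* §2 per comparison height `n < K`, for a selector `Umin` with r1's two clauses (the conclusion of `exists_measurable_umin`): the FIBRE IDENTITY
  `D_{n,K}(Umin V) = V` and the STRICT ALL-LEVEL BOUND `|avg^j(Umin V)(∂q) − 1| < 2B₃ε₁(L^jη)²`, `j ≤ K − n`, for every shell radius `ε₁` bounding `V`
  (Prop. 2 PROVED for (0.4): `BlockAveragingEMLProp2.plaqSmall_iter_blockAvg_eml_level`, fed by `Umin V ∈ 𝔘_k(B₃ε₁)`).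
* §3 ★★ `exists_measurable_pinnedFamily_rows`: ONE family `UminT k` of run `K` with (i) measurability, (ii) `UminT 0 = id`, (iii) r1's text,
  (iv) `avg^k (UminT k W) = W` and (v) `|avg^s(UminT k W)(∂q) − 1| < 2B₃ε₁(L^s(L^k)⁻¹)²` (`s ≤ k`, `1 ≤ k ≤ K`) for every `ε₁`-small `W`, `0 < ε₁ ≤ a₁`.
* §4 the record's r2 ∕ r3 TEXTS at `Hist.triv` for ANY family with (ii), (iv), (v): `row2_triv_of_fibreId` (under the window smallness
  `2L²·B·θBal(K−k+1) ≤ a₁`) and `row3_triv_of_levelBound` (under a `C68`-condition of the located type (N1):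
  `2B₃·2L²Bθ(K−k+1)·L^{−2(k−i)} ≤ C68·θ(K−i)`, `i ≤ k ≤ K`, and `1 ≤ 2B₃`).
HONEST FRAMING.  Kernel theorems about the tree's own objects; `Thm1GlobalMinAt` stays displayed; the smallness∕largeness provisos are explicit
hypotheses for the record's exhibition of `𝔠` to meet (all free upward∕downward: `a₁`, `γ₀`, `C68`).  No `def`, no `instance`, no `sorry`;
count-neutral; not a claim about the continuum limit or the mass gap.
References: T. Bałaban, Commun. Math. Phys. 102 (1985) 277–309 [Balaban1985Variational], Thm 1 (6)–(8) pp. 278–279; Commun. Math. Phys. 102 (1985)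
255–275 [Balaban1985UV3], (40)–(42) p. 266, (68) p. 273; Commun. Math. Phys. 98 (1985) 17–51 [Balaban1985Averaging], Prop. 2 (52)–(54) p. 26.
-/

set_option autoImplicit false

noncomputable section

namespace Summit.QuantumFields.YangMills.Theorems.MinimiserPin

open Set Filter Topology MeasureTheory
open scoped Matrix.Norms.L2Operator
open Literature.MathematicalPhysics.QuantumFieldTheory.Balaban1983to89
open Literature.MathematicalPhysics.QuantumFieldTheory.Balaban1983to89.T3ContinuumYM3Torus
open Literature.MathematicalPhysics.QuantumFieldTheory.Balaban1983to89.T3UnitLawDensityEML (ℰp)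
open Literature.MathematicalPhysics.QuantumFieldTheory.Balaban1983to89.T3UnitScaleTilt (θBal)
open Literature.MathematicalPhysics.QuantumFieldTheory.Balaban1983to89.T3MinimiserStabilityReduction (θBal_pos)
open Literature.MathematicalPhysics.QuantumFieldTheory.Balaban1983to89.T3PrintedRegularMinimiser (RegPr DivSmall regFibrePr)
open Literature.MathematicalPhysics.QuantumFieldTheory.Balaban1983to89.T3PrintedMinimiserExistence (Thm1GlobalMinAt regFibrePr_mono)
open Literature.MathematicalPhysics.QuantumFieldTheory.Balaban1983to89.T3RegularMinimiser (regThreshold)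
open Literature.MathematicalPhysics.QuantumFieldTheory.Balaban1983to89.T3TiltDescent (descendTo)
open Literature.MathematicalPhysics.QuantumFieldTheory.Balaban1983to89.T3LevelShift
  (fieldShift fieldShift_fieldShift fieldShift_refl fieldShift_fieldShift_symm measurable_fieldShift plaqShift plaqHol_fieldShift)
open Literature.MathematicalPhysics.QuantumFieldTheory.Balaban1983to89.ExpMeanLog (deltaSU)
open Literature.MathematicalPhysics.QuantumFieldTheory.Balaban1983to89.BlockAveraging (blockAvg)
open Literature.MathematicalPhysics.QuantumFieldTheory.Balaban1983to89.BlockAveragingEMLProp2 (plaqSmall_iter_blockAvg_eml_level)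
open Literature.MathematicalPhysics.QuantumFieldTheory.Balaban1983to89.B10Eq38TorusDomains (plaqsIn mem_plaqsIn_iff)
open Literature.MathematicalPhysics.QuantumFieldTheory.Balaban1983to89.B10Eq42TorusConstraint (bondsIn lam42)
open Summit.QuantumFields.Balaban3D.Carriers (Hist Omega Omega_triv)

variable (F : T3Family)

/-! ## §1 Letters -/

section Letters

/-- Plaquette smallness is read through the tower re-indexing (`U(∂p)` of `fieldShift h V` is `U(∂(plaqShift h p))` of `V`). [cite: Balaban1987RG1, (0.2) p.252 (bookkeeping)] -/
theorem plaqSmall_fieldShift {G : Type*} [GaugeGroup G] {m K j m' K' j' : ℕ} (h : (F.PP m K).sitesPerDir j = (F.PP m' K').sitesPerDir j')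
    {δ : ℝ} {V : GaugeField (F.PP m' K') j' G} (hV : PlaqSmall δ V) : PlaqSmall δ (fieldShift h V) := fun p => by
  rw [plaqHol_fieldShift]
  exact hV _

/-- Cancellation of the re-indexing along a propositional equality of levels: `fieldShift e₁ (avg^{j₁} U) = fieldShift e₂ W` with `j₁ = j₂`
gives `avg^{j₂} U = W`. [cite: Balaban1987RG1, (0.11) p.253 (bookkeeping)] -/
theorem iter_eq_of_fieldShift_eq {G : Type*} [GaugeGroup G] {n K j₁ j₂ : ℕ} (hj : j₁ = j₂)
    (e₁ : (F.PP F.m n).sitesPerDir 0 = (F.PP F.m K).sitesPerDir j₁) (e₂ : (F.PP F.m n).sitesPerDir 0 = (F.PP F.m K).sitesPerDir j₂)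
    (X : (j : ℕ) → GaugeField (F.P K) j G) (W : GaugeField (F.P K) j₂ G) (h : fieldShift e₁ (X j₁) = fieldShift e₂ W) : X j₂ = W := by
  subst hj
  have h1 : fieldShift e₁.symm (fieldShift e₁ (X j₁)) = X j₁ := fieldShift_fieldShift_symm e₁ _
  have h2 : fieldShift e₁.symm (fieldShift e₂ W) = W := fieldShift_fieldShift_symm e₂ W
  rw [← h1, h, h2]

/-- **THE (40) WINDOW AT THE TRIVIAL HISTORY IS A PLAIN SMALLNESS CONDITION**: `Ω_k(triv) = T_η` (`Carriers.Omega_triv`), so every level-`k` plaquette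
lies in `plaqsIn k (Ω_k(triv))`. [cite: Balaban1985UV3, (40) p.266] -/
theorem plaqSmall_of_plaqSmallOn_triv (M₁ : ℕ) (Rcol : ℕ → ℕ) {K k j : ℕ} {δ : ℝ}
    {W : GaugeField (F.P K) k (Matrix.specialUnitaryGroup (Fin 2) ℂ)}
    (hW : PlaqSmallOn (↑(plaqsIn k (Omega M₁ Rcol k (Hist.triv (F.P K) k) j))) δ W) : PlaqSmall δ W := fun p =>
  hW p (by
    rw [Finset.mem_coe, mem_plaqsIn_iff, Omega_triv]
    exact Set.subset_univ _)

/-- Power bookkeeping: `(L^s·(L^k)⁻¹)² = ((L^{k−i})⁻¹)²·((L^{i−s})⁻¹)²` for `s ≤ i ≤ k`. [folklore] -/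
theorem pow_ratio_sq_eq {x : ℝ} (hx : x ≠ 0) {s i k : ℕ} (hsi : s ≤ i) (hik : i ≤ k) :
    (x ^ s * (x ^ k)⁻¹) ^ 2 = ((x ^ (k - i))⁻¹) ^ 2 * ((x ^ (i - s))⁻¹) ^ 2 := by
  have hk : x ^ k = x ^ s * (x ^ (i - s) * x ^ (k - i)) := by
    rw [← pow_add, ← pow_add]
    congr 1
    omega
  rw [hk, mul_inv, ← mul_assoc, mul_inv_cancel₀ (pow_ne_zero _ hx), one_mul, mul_inv, mul_pow, mul_comm]

end Letters

/-! ## §2 Per comparison height: the fibre identity and the strict all-level bound of a selector with r1's clauses -/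

section Height

variable {a₀ a₁ B₃ : ℝ} {n K : ℕ} (hnK : n < K)
  {Umin : GaugeField (F.P n) 0 (Matrix.specialUnitaryGroup (Fin 2) ℂ) → GaugeField (F.P K) 0 (Matrix.specialUnitaryGroup (Fin 2) ℂ)}

/-- **THE PIN LIES IN THE DESCENT FIBRE**: `D_{n,K}(Umin V) = V` for every datum inside the shell. [cite: Balaban1985Variational, (3), (6) p.278] -/
theorem descendTo_umin_eq (hwin : B₃ * a₁ ≤ a₀)
    (hU : ∀ (ε₁ ε₀ : ℝ), 0 < ε₁ → ε₁ ≤ a₁ → B₃ * ε₁ ≤ ε₀ → ε₀ ≤ a₀ →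
      ∀ V : GaugeField (F.P n) 0 (Matrix.specialUnitaryGroup (Fin 2) ℂ), PlaqSmall ε₁ V →
        Umin V ∈ regFibrePr F n K hnK.le (B₃ * ε₁) V ∧
          IsMinOn (fun W : GaugeField (F.P K) 0 (Matrix.specialUnitaryGroup (Fin 2) ℂ) => wilsonAction4 W) (regFibrePr F n K hnK.le ε₀ V) (Umin V))
    (hB₃ : 0 ≤ B₃) {ε₁ : ℝ} (hε₁ : 0 < ε₁) (hε₁a : ε₁ ≤ a₁) (V : GaugeField (F.P n) 0 (Matrix.specialUnitaryGroup (Fin 2) ℂ))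
    (hV : PlaqSmall ε₁ V) : descendTo F ℰp n K hnK.le (Umin V) = V :=
  (hU ε₁ a₀ hε₁ hε₁a ((mul_le_mul_of_nonneg_left hε₁a hB₃).trans hwin) le_rfl V hV).1.1.1

/-- **THE STRICT ALL-LEVEL BOUND ALONG THE PIN**: `Umin V ∈ 𝔘_k(B₃ε₁)` (`k = K − n`) and Proposition 2 for (0.4) give
`|avg^j(Umin V)(∂q) − 1| < 2B₃ε₁·(L^j(L^k)⁻¹)²` for every `j ≤ k` and every plaquette, whenever `2B₃a₁` is admissible as in (53).
[cite: Balaban1985Averaging, Prop. 2 (52)–(54) p.26; Balaban1985Variational, (2), (8) pp.278–279] -/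
theorem dist1_iter_umin_lt (hwin : B₃ * a₁ ≤ a₀)
    (hU : ∀ (ε₁ ε₀ : ℝ), 0 < ε₁ → ε₁ ≤ a₁ → B₃ * ε₁ ≤ ε₀ → ε₀ ≤ a₀ →
      ∀ V : GaugeField (F.P n) 0 (Matrix.specialUnitaryGroup (Fin 2) ℂ), PlaqSmall ε₁ V →
        Umin V ∈ regFibrePr F n K hnK.le (B₃ * ε₁) V ∧
          IsMinOn (fun W : GaugeField (F.P K) 0 (Matrix.specialUnitaryGroup (Fin 2) ℂ) => wilsonAction4 W) (regFibrePr F n K hnK.le ε₀ V) (Umin V))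
    (hB₃ : 0 < B₃)
    (hA3 : (143 * ((((3 + 4 : ℕ) : ℝ)) ^ 2 / 4) ^ 2) * (2 * (B₃ * a₁)) ≤ 1 / 3)
    (hA2 : 2 * (2 * (B₃ * a₁)) ≤ 2 * deltaSU (Fin 2) / (((3 + 4) * F.L : ℕ) : ℝ) ^ 2)
    {ε₁ : ℝ} (hε₁ : 0 < ε₁) (hε₁a : ε₁ ≤ a₁) (V : GaugeField (F.P n) 0 (Matrix.specialUnitaryGroup (Fin 2) ℂ)) (hV : PlaqSmall ε₁ V)
    {j : ℕ} (hj : j ≤ K - n) (q : Plaq (F.P K) j) :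
    GaugeGroup.dist1 (GaugeField.plaqHol
        (Averaging.iter (fun i => blockAvg (P := F.P K) (j := i) ℰp) j (Umin V)) q) <
      2 * (B₃ * ε₁) * (((F.P K).L : ℝ) ^ j * (((F.P K).L : ℝ) ^ (K - n))⁻¹) ^ 2 := by
  have hmem := (hU ε₁ a₀ hε₁ hε₁a ((mul_le_mul_of_nonneg_left hε₁a hB₃.le).trans hwin) le_rfl V hV).1
  have hpl : PlaqSmall (regThreshold F n K (B₃ * ε₁)) (Umin V) := hmem.1.2
  rw [regThreshold_eq] at hpl
  have hα : 0 < B₃ * ε₁ := mul_pos hB₃ hε₁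
  have hle : B₃ * ε₁ ≤ 2 * (B₃ * a₁) := by nlinarith [mul_le_mul_of_nonneg_left hε₁a hB₃.le]
  have hC : (0 : ℝ) ≤ 143 * ((((3 + 4 : ℕ) : ℝ)) ^ 2 / 4) ^ 2 := by positivity
  have hα3 : (143 * (((((F.P K).d + 4 : ℕ) : ℝ)) ^ 2 / 4) ^ 2) * (B₃ * ε₁) ≤ 1 / 3 :=
    (mul_le_mul_of_nonneg_left hle hC).trans hA3
  have hα2 : 2 * (B₃ * ε₁) ≤ 2 * deltaSU (Fin 2) / ((((F.P K).d + 4) * (F.P K).L : ℕ) : ℝ) ^ 2 := by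
    have : 2 * (B₃ * ε₁) ≤ 2 * (2 * (B₃ * a₁)) := by linarith
    exact this.trans hA2
  exact plaqSmall_iter_blockAvg_eml_level (n := Fin 2) (P := F.P K) (K - n) hα hα3 hα2 hpl hj q

end Height

/-! ## §3 ★★ The pinned family of run `K`: measurability, identity at level 0, r1, the fibre identity, the all-level bound -/

section Family

/-- ★★ **THE PINNED TRIVIAL-HISTORY MINIMISERS OF RUN `K`, WITH EVERYTHING THE TRIVIAL HISTORY ASKS.**  Under the hypotheses of
`exists_uniform_regMinimiser` there is a family `UminT : (k : ℕ) → GaugeField (F.P K) k → GaugeField (F.P K) 0` with: (i) every member measurable;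
(ii) `UminT 0 = id`; (iii) THE TEXT of `MinimiserRowsT3` conjunct 1 (r1) for `U_k(·, triv) := UminT k`; (iv) THE FIBRE IDENTITY
`avg^k (UminT k W) = W` for `k ≤ K` and every `W` that is `ε₁`-small for some `0 < ε₁ ≤ a₁`; (v) THE STRICT ALL-LEVEL BOUND
`|avg^s(UminT k W)(∂q) − 1| < 2B₃ε₁·(L^s(L^k)⁻¹)²` for `1 ≤ k ≤ K`, `s ≤ k`, every plaquette `q` and every such `(ε₁, W)`.
[cite: Balaban1985Variational, Thm 1 (6)–(8) pp.278–279; Balaban1985Averaging, Prop. 2 (52)–(54) p.26] -/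
theorem exists_measurable_pinnedFamily_rows {a₀ a₁ B₃ : ℝ} (hT : Thm1GlobalMinAt F.L a₀ a₁ B₃) (hB₃ : 0 < B₃) (hwin : B₃ * a₁ ≤ a₀)
    (hA3 : (143 * ((((3 + 4 : ℕ) : ℝ)) ^ 2 / 4) ^ 2) * (2 * (B₃ * a₁)) ≤ 1 / 3)
    (hA2 : 2 * (2 * (B₃ * a₁)) ≤ 2 * deltaSU (Fin 2) / (((3 + 4) * F.L : ℕ) : ℝ) ^ 2) (K : ℕ) :
    ∃ UminT : (k : ℕ) → GaugeField (F.P K) k (Matrix.specialUnitaryGroup (Fin 2) ℂ) →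
        GaugeField (F.P K) 0 (Matrix.specialUnitaryGroup (Fin 2) ℂ),
      (∀ k, Measurable (UminT k)) ∧
      (∀ V : GaugeField (F.P K) 0 (Matrix.specialUnitaryGroup (Fin 2) ℂ), UminT 0 V = V) ∧
      (∀ (n : ℕ) (hnK : n < K) (ε₁ ε₀ : ℝ), 0 < ε₁ → ε₁ ≤ a₁ → B₃ * ε₁ ≤ ε₀ → ε₀ ≤ a₀ →
        ∀ V : GaugeField (F.P n) 0 (Matrix.specialUnitaryGroup (Fin 2) ℂ), PlaqSmall ε₁ V →
          UminT (K - n) (fieldShift (F.sitesPerDir_eq (m := F.m) (K := K) (j := K - n) (m' := F.m) (K' := n) (j' := 0) (by omega)) V) ∈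
              regFibrePr F n K hnK.le (B₃ * ε₁) V ∧
            IsMinOn (fun U : GaugeField (F.P K) 0 (Matrix.specialUnitaryGroup (Fin 2) ℂ) => wilsonAction4 U)
              (regFibrePr F n K hnK.le ε₀ V)
              (UminT (K - n)
                (fieldShift (F.sitesPerDir_eq (m := F.m) (K := K) (j := K - n) (m' := F.m) (K' := n) (j' := 0) (by omega)) V))) ∧
      (∀ (k : ℕ), k ≤ K → ∀ (ε₁ : ℝ), 0 < ε₁ → ε₁ ≤ a₁ →
        ∀ W : GaugeField (F.P K) k (Matrix.specialUnitaryGroup (Fin 2) ℂ), PlaqSmall ε₁ W →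
          Averaging.iter (fun i => blockAvg (P := F.P K) (j := i) ℰp) k (UminT k W) = W) ∧
      (∀ (k : ℕ), 1 ≤ k → k ≤ K → ∀ (ε₁ : ℝ), 0 < ε₁ → ε₁ ≤ a₁ →
        ∀ W : GaugeField (F.P K) k (Matrix.specialUnitaryGroup (Fin 2) ℂ), PlaqSmall ε₁ W →
          ∀ s, s ≤ k → ∀ q : Plaq (F.P K) s,
            GaugeGroup.dist1 (GaugeField.plaqHol (Averaging.iter (fun i => blockAvg (P := F.P K) (j := i) ℰp) s (UminT k W)) q) <
              2 * (B₃ * ε₁) * (((F.L : ℝ)) ^ s * (((F.L : ℝ)) ^ k)⁻¹) ^ 2) := by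
  classical
  -- a measurable selector at every comparison height (junk beyond the run), as in `exists_measurable_pinnedFamily`
  have key : ∀ n : ℕ, ∃ Umin : GaugeField (F.P n) 0 (Matrix.specialUnitaryGroup (Fin 2) ℂ) →
      GaugeField (F.P K) 0 (Matrix.specialUnitaryGroup (Fin 2) ℂ), Measurable Umin ∧
        ∀ (hnK : n < K) (ε₁ ε₀ : ℝ), 0 < ε₁ → ε₁ ≤ a₁ → B₃ * ε₁ ≤ ε₀ → ε₀ ≤ a₀ →
          ∀ V : GaugeField (F.P n) 0 (Matrix.specialUnitaryGroup (Fin 2) ℂ), PlaqSmall ε₁ V →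
            Umin V ∈ regFibrePr F n K hnK.le (B₃ * ε₁) V ∧
              IsMinOn (fun W : GaugeField (F.P K) 0 (Matrix.specialUnitaryGroup (Fin 2) ℂ) => wilsonAction4 W)
                (regFibrePr F n K hnK.le ε₀ V) (Umin V) := by
    intro n
    by_cases hnK : n < K
    · obtain ⟨Umin, hm, hU⟩ := exists_measurable_umin F hT hB₃ hwin hA3 hA2 n K hnK
      exact ⟨Umin, hm, fun _ => hU⟩
    · exact ⟨fun _ => 1, measurable_const, fun h => absurd h hnK⟩
  choose Umin hUmeas hUmin using key
  -- abbreviations for the two re-indexings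
  have eT : ∀ {k : ℕ}, 1 ≤ k ∧ k ≤ K → (F.PP F.m (K - k)).sitesPerDir 0 = (F.PP F.m K).sitesPerDir k := fun {k} hk =>
    F.sitesPerDir_eq (m := F.m) (K := K - k) (j := 0) (m' := F.m) (K' := K) (j' := k) (by omega)
  have e0 : ∀ {k : ℕ}, k = 0 → (F.PP F.m K).sitesPerDir 0 = (F.PP F.m K).sitesPerDir k := fun {k} hk =>
    F.sitesPerDir_eq (m := F.m) (K := K) (j := 0) (m' := F.m) (K' := K) (j' := k) (by omega)
  refine ⟨fun k W => if hk : 1 ≤ k ∧ k ≤ K then Umin (K - k) (fieldShift (eT hk) W)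
    else if hk0 : k = 0 then fieldShift (e0 hk0) W else 1, fun k => ?_, fun V => ?_, fun n hnK ε₁ ε₀ h₁ h₂ h₃ h₄ V hV => ?_,
    fun k hk ε₁ hε₁ hε₁a W hW => ?_, fun k hk1 hk ε₁ hε₁ hε₁a W hW s hs q => ?_⟩
  · -- (i) measurability, branch by branch
    by_cases hk : 1 ≤ k ∧ k ≤ K
    · simp only [dif_pos hk]
      exact (hUmeas _).comp (measurable_fieldShift _)
    · by_cases hk0 : k = 0
      · simp only [dif_neg hk, dif_pos hk0]
        exact measurable_fieldShift _
      · simp only [dif_neg hk, dif_neg hk0]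
        exact measurable_const
  · -- (ii) level `0` is the identity
    have h0 : ¬ (1 ≤ 0 ∧ 0 ≤ K) := fun h => absurd h.1 (by omega)
    beta_reduce
    rw [dif_neg h0, dif_pos rfl]
    exact fieldShift_refl _ V
  · -- (iii) the r1 text at `k = K − n`
    have hk : 1 ≤ K - n ∧ K - n ≤ K := ⟨by omega, by omega⟩
    beta_reduce
    rw [dif_pos hk]
    rw [umin_fieldShift_fieldShift F Umin (Nat.sub_sub_self hnK.le)]
    exact hUmin n hnK ε₁ ε₀ h₁ h₂ h₃ h₄ V hV
  · -- (iv) the fibre identity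
    rcases Nat.eq_zero_or_pos k with rfl | hkpos
    · have h0 : ¬ (1 ≤ 0 ∧ 0 ≤ K) := fun h => absurd h.1 (by omega)
      beta_reduce
      rw [dif_neg h0, dif_pos rfl]
      exact fieldShift_refl _ W
    · have hk' : 1 ≤ k ∧ k ≤ K := ⟨hkpos, hk⟩
      have hnK : K - k < K := by omega
      beta_reduce
      rw [dif_pos hk']
      have hfib := descendTo_umin_eq F hnK hwin (hUmin (K - k) hnK) hB₃.le hε₁ hε₁a (fieldShift (eT hk') W)
        (plaqSmall_fieldShift F _ hW)
      -- `descendTo = fieldShift ∘ avg^{K − (K − k)}`; cancel the re-indexing along `K − (K − k) = k`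
      exact iter_eq_of_fieldShift_eq F (Nat.sub_sub_self hk) _ (eT hk')
        (fun j => Averaging.iter (fun i => blockAvg (P := F.P K) (j := i) ℰp) j (Umin (K - k) (fieldShift (eT hk') W))) W hfib
  · -- (v) the strict all-level bound
    have hk' : 1 ≤ k ∧ k ≤ K := ⟨hk1, hk⟩
    have hnK : K - k < K := by omega
    beta_reduce
    rw [dif_pos hk']
    have h := dist1_iter_umin_lt F hnK hwin (hUmin (K - k) hnK) hB₃ hA3 hA2 hε₁ hε₁a (fieldShift (eT hk') W)
      (plaqSmall_fieldShift F _ hW) (j := s) (by omega) q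
    rwa [Nat.sub_sub_self hk] at h

end Family

/-! ## §4 The record's rows r2 and r3 at the trivial history, for any family with the fibre identity and the all-level bound -/

section Rows

variable {K : ℕ} {a₁ B₃ : ℝ}
  (UminT : (k : ℕ) → GaugeField (F.P K) k (Matrix.specialUnitaryGroup (Fin 2) ℂ) → GaugeField (F.P K) 0 (Matrix.specialUnitaryGroup (Fin 2) ℂ))

/-- ★ **ROW r2 AT THE TRIVIAL HISTORY** (the text of `MinimiserRowsT3` conjunct 2 at `h = Hist.triv`, its `ChargedT3` guard unfolded to the (40)
window): for a family with the fibre identity (iv), every `k ≤ K` and every `W` in the level-`k` window `2L²·B·θBal(K−k+1)` — a window INSIDE the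
shell, `2L²·B·θBal(K−k+1) ≤ a₁` — the `k`-fold average of `UminT k W` equals `W` on every bond (a fortiori on the bonds of `Ω_k(triv) = T_η`).
[cite: Balaban1985UV3, (40)–(42) p.266] -/
theorem row2_triv_of_fibreId (γ b₀ p₀ B : ℝ) (M₁ : ℕ) (Rcol : ℕ → ℕ) (ha₁ : 0 < a₁)
    (hfib : ∀ (k : ℕ), k ≤ K → ∀ (ε₁ : ℝ), 0 < ε₁ → ε₁ ≤ a₁ →
      ∀ W : GaugeField (F.P K) k (Matrix.specialUnitaryGroup (Fin 2) ℂ), PlaqSmall ε₁ W →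
        Averaging.iter (fun i => blockAvg (P := F.P K) (j := i) ℰp) k (UminT k W) = W)
    (hwa : ∀ k, k ≤ K → 2 * (F.L : ℝ) ^ 2 * B * θBal F.L γ b₀ p₀ (K - k + 1) ≤ a₁) :
    ∀ (k : ℕ), k ≤ K → ∀ (W : GaugeField (F.P K) k (Matrix.specialUnitaryGroup (Fin 2) ℂ)),
      PlaqSmallOn (↑(plaqsIn k (Omega M₁ Rcol k (Hist.triv (F.P K) k) k))) (2 * (F.L : ℝ) ^ 2 * B * θBal F.L γ b₀ p₀ (K - k + 1)) W →
        ∀ b : PBond (F.P K) k, b ∈ bondsIn k (Omega M₁ Rcol k (Hist.triv (F.P K) k) k) →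
          Averaging.iter (fun i => blockAvg (P := F.P K) (j := i) ℰp) k (UminT k W) b = W b := by
  intro k hk W hW b _
  have hsm : PlaqSmall a₁ W := fun p => (plaqSmall_of_plaqSmallOn_triv F M₁ Rcol hW p).trans_le (hwa k hk)
  rw [hfib k hk a₁ ha₁ le_rfl W hsm]

/-- ★ **ROW r3 AT THE TRIVIAL HISTORY** (the text of `MinimiserRowsT3` conjunct 3 at `h = Hist.triv`, guard unfolded): for a family with (ii) and the
all-level bound (v), every `k ≤ K`, every `W` in the level-`k` window (inside the shell), all `s ≤ i ≤ k` and every level-`s` plaquette (a fortiori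
those under `Λ_i(triv)`): `|avg^s(UminT k W)(∂q) − 1| ≤ C68·θBal(K−i)·L^{−2(i−s)}`, PROVIDED the regularity constant dominates the window in the
located form (N1) `2B₃·(2L²Bθ(K−k+1))·L^{−2(k−i)} ≤ C68·θ(K−i)` (`i ≤ k ≤ K`) and `1 ≤ 2B₃` (level `k = 0` reads the window itself).
[cite: Balaban1985UV3, (40) p.266 and (68) p.273; Balaban1985Averaging, Prop. 2 (54) p.26] -/
theorem row3_triv_of_levelBound (γ b₀ p₀ B C68 : ℝ) (M₁ : ℕ) (Rcol : ℕ → ℕ) (hγ : 0 < γ) (hγ1 : γ ≤ 1) (hb₀ : 0 < b₀) (hB : 0 < B)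
    (hB₃ : 1 ≤ 2 * B₃)
    (h0 : ∀ V : GaugeField (F.P K) 0 (Matrix.specialUnitaryGroup (Fin 2) ℂ), UminT 0 V = V)
    (hlev : ∀ (k : ℕ), 1 ≤ k → k ≤ K → ∀ (ε₁ : ℝ), 0 < ε₁ → ε₁ ≤ a₁ →
      ∀ W : GaugeField (F.P K) k (Matrix.specialUnitaryGroup (Fin 2) ℂ), PlaqSmall ε₁ W →
        ∀ s, s ≤ k → ∀ q : Plaq (F.P K) s,
          GaugeGroup.dist1 (GaugeField.plaqHol (Averaging.iter (fun i => blockAvg (P := F.P K) (j := i) ℰp) s (UminT k W)) q) <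
            2 * (B₃ * ε₁) * (((F.L : ℝ)) ^ s * (((F.L : ℝ)) ^ k)⁻¹) ^ 2)
    (hwa : ∀ k, k ≤ K → 2 * (F.L : ℝ) ^ 2 * B * θBal F.L γ b₀ p₀ (K - k + 1) ≤ a₁)
    (hC68 : ∀ k i, i ≤ k → k ≤ K →
      2 * B₃ * (2 * (F.L : ℝ) ^ 2 * B * θBal F.L γ b₀ p₀ (K - k + 1)) * (((F.L : ℝ) ^ (k - i))⁻¹) ^ 2 ≤ C68 * θBal F.L γ b₀ p₀ (K - i)) :
    ∀ (k : ℕ), k ≤ K → ∀ (W : GaugeField (F.P K) k (Matrix.specialUnitaryGroup (Fin 2) ℂ)),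
      PlaqSmallOn (↑(plaqsIn k (Omega M₁ Rcol k (Hist.triv (F.P K) k) k))) (2 * (F.L : ℝ) ^ 2 * B * θBal F.L γ b₀ p₀ (K - k + 1)) W →
        ∀ i, i ≤ k → ∀ s, s ≤ i → ∀ q : Plaq (F.P K) s,
          q ∈ plaqsIn s (lam42 (Omega M₁ Rcol k (Hist.triv (F.P K) k)) k i) →
            GaugeGroup.dist1 (GaugeField.plaqHol (Averaging.iter (fun l => BlockAveraging.blockAvg (P := F.P K) (j := l) ℰp) s (UminT k W)) q) ≤
              C68 * θBal F.L γ b₀ p₀ (K - i) * (((F.L : ℝ) ^ (i - s))⁻¹) ^ 2 := by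
  intro k hk W hW i hik s hsi q _
  have hL1 : 1 ≤ F.L := by have := F.hL.2; omega
  have hLpos : (0 : ℝ) < (F.L : ℝ) := by exact_mod_cast (by omega : 0 < F.L)
  set w : ℝ := 2 * (F.L : ℝ) ^ 2 * B * θBal F.L γ b₀ p₀ (K - k + 1) with hw_def
  have hwpos : 0 < w := by
    have := θBal_pos hL1 hγ hγ1 hb₀ p₀ (K - k + 1)
    positivity
  have hsm : PlaqSmall w W := plaqSmall_of_plaqSmallOn_triv F M₁ Rcol hW
  have hC := hC68 k i hik hk
  have hpi : (0 : ℝ) < (((F.L : ℝ) ^ (i - s))⁻¹) ^ 2 := by positivity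
  rcases Nat.eq_zero_or_pos k with rfl | hkpos
  · -- level `0`: the datum itself, read against the window
    obtain rfl : i = 0 := Nat.le_zero.mp hik
    obtain rfl : s = 0 := Nat.le_zero.mp hsi
    have hq : GaugeGroup.dist1 (GaugeField.plaqHol W q) < w := hsm q
    have hid : Averaging.iter (fun l => BlockAveraging.blockAvg (P := F.P K) (j := l) ℰp) 0 (UminT 0 W) = W := h0 W
    rw [hid]
    have hC' : 2 * B₃ * w ≤ C68 * θBal F.L γ b₀ p₀ (K - 0) := by
      simpa only [hw_def, Nat.sub_self, pow_zero, inv_one, one_pow, mul_one] using hC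
    have hpw : 0 ≤ (2 * B₃ - 1) * w := mul_nonneg (by linarith) hwpos.le
    have h1 : (((F.L : ℝ) ^ (0 - 0))⁻¹) ^ 2 = 1 := by simp
    rw [h1, mul_one]
    nlinarith [hC', hq, hpw]
  · -- level `k ≥ 1`: the all-level bound at `ε₁ := w`, then the `C68`-condition
    have hlt := hlev k hkpos hk w hwpos (hwa k hk) W hsm s (hsi.trans hik) q
    refine hlt.le.trans ?_
    rw [pow_ratio_sq_eq hLpos.ne' hsi hik]
    have : 2 * (B₃ * w) * ((((F.L : ℝ) ^ (k - i))⁻¹) ^ 2 * (((F.L : ℝ) ^ (i - s))⁻¹) ^ 2) =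
        (2 * B₃ * w * (((F.L : ℝ) ^ (k - i))⁻¹) ^ 2) * (((F.L : ℝ) ^ (i - s))⁻¹) ^ 2 := by ring
    rw [this]
    exact mul_le_mul_of_nonneg_right hC hpi.le

end Rows

end Summit.QuantumFields.YangMills.Theorems.MinimiserPin

end
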